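import Literature.NumberTheory.Rogawski1990.ArchSingularCentralizerGlobalCoherenceAllWalls   -- ★ (W3-all) `exists_conj_coherent_pinned_telescope_all_of_links`
import Literature.NumberTheory.Automorphic.UnitOrbitalIntegralFixedPoints                     -- ★ `exists_isHaarMeasure_isInvInvariant_univ_eq_one` (probability Haar on a compact centraliser)
import HarnessLib

/-!
# The pinned centraliser families at the split-singular walls EXIST, and the one-stop (ST-∞) feed («(E4b)∕(W3-pins)»; Rogawski (1990) §1.7 p. 6, §4.3 (4.3.1) p. 43,
# §8.2 pp. 122–124)

Topic `NumberTheory/Rogawski1990`; namespace `Literature.NumberTheory.Rogawski1990`.  THEOREMS ONLY (no definition, no instance, no notation, no named fact, no `sorry`).  Cell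
`pub/hodgecm-mathlib`, ENGINE T1, crux H413 = `stmt-HodgeConjecture-24833` (supports-only); (ST-∞) dress, census `CENSUS-E4b-SingularPinsBuilt` 1291225b (pin (i), LEAD T9-8 (G),
T9-15 (4)); after ★ (W3-all).  Count-neutral plumbing.  HONEST LABEL: HC_CM is proved only modulo the printed citations until rung 0 closes; this file pays nothing by itself.

* **`exists_pinned_centralizer_families`** — given the reference wall measures `νH w τ` (Haar, inversion invariant) and any family of wall data `z0 k` in normal form, there ARE
  per-datum per-place centraliser measures `ρZ k w σ` on the `Z_w(diag(z0 k w∘σ)) ≤ G_w(α)` with ★ (D5)'s `hρZi` and `hρZ` (at the noncompact walls: the transport of `νH w σ⁻¹`,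
  BY DEFINITION) and PROBABILITY mass at the compact walls (`hρZ1`; ★ `isCompact_centralizer_circleDiagonal_comp_of_pos` + ★ `exists_isHaarMeasure_isInvInvariant_univ_eq_one`).
* **`exists_pins_conj_coherent_telescope_all`** — ONE-STOP: reference measures + their (T02)(T01) links (★ `…PinTransport`) + an injective family of wall data ⟹ `ρZ ρP ρ′ T` with
  `hρZi hρZ hρZ1 hρPi hρP hρ′i hρ′`, `T (t(z0 k∘ρ)) = ρ′ k ρ`, Haar∕inversion invariance and conjugation coherence of `T` on the union of the wall classes (★ (W3-all)).  This is the
  whole singular-pin input of the (ST-∞-s) END (★ p843392 `hpinα∕hpinβ`, via ★ `IsQuotientOf.atPoint_eq_quotientMeasure_of_forall_map_conj_eq`) for ONE witness family.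

## References
* [Rogawski1990] J. D. Rogawski, *Automorphic Representations of Unitary Groups in Three Variables*, Ann. of Math. Stud. 123 (1990), §1.7 p. 6; §4.3 (4.3.1) p. 43; §8.2 pp. 122–124.
* [DeitmarEchterhoff2014] A. Deitmar, S. Echterhoff, *Principles of Harmonic Analysis*, 2nd ed. (2014), Thm. 1.5.3.
-/

set_option autoImplicit false

noncomputable section

open MeasureTheory Measure Set NumberField NumberField.InfinitePlace Matrix Equiv
open Literature.MeasureTheory.Group Literature.NumberTheory.Automorphic Literature.NumberTheory.Automorphic.UnitaryGroup
open scoped ENNReal NNReal Classical MatrixGroups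

namespace Literature.NumberTheory.Rogawski1990

variable (L : Type) [Field L] [NumberField L] [IsCMField L] (α : Fin 3 → L)
  [MeasurableSpace (GL (Fin 3) ℂ)] [BorelSpace (GL (Fin 3) ℂ)]

omit [NumberField L] [IsCMField L] in
/-- **THE PINNED CENTRALISER FAMILIES EXIST** (pin (i)): at a noncompact wall the transport of the reference measure `νH w σ⁻¹` (so ★ (D5)'s `hρZ` holds by definition; Haar and
inversion invariant by transport), at a compact wall the probability Haar measure of the compact centraliser (★ `isCompact_centralizer_circleDiagonal_comp_of_pos`, ★
`exists_isHaarMeasure_isInvInvariant_univ_eq_one`). [cite: Rogawski1990, §1.7 p. 6; §4.3 (4.3.1) p. 43] [cite: DeitmarEchterhoff2014, Thm. 1.5.3] -/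
theorem exists_pinned_centralizer_families
    (hα : ∀ i, α i ≠ 0) (hreal : ∀ (w : {w : InfinitePlace L // IsComplex w}) (i : Fin 3), (w.1.embedding (α i)).im = 0)
    (z₁ : {w : InfinitePlace L // IsComplex w} → Fin 3 → Circle) (h02 : ∀ w, z₁ w 0 = z₁ w 2) (h01 : ∀ w, z₁ w 0 ≠ z₁ w 1)
    (νH : ∀ (w : {w : InfinitePlace L // IsComplex w}) (τ : Perm (Fin 3)), Measure (Subgroup.centralizer ({(⟨circleDiagonal 3 (z₁ w), circleDiagonal_mem_archLocal_diagonal L 3 (α ∘ ⇑τ) w (z₁ w)⟩ : archLocal L 3 (Matrix.diagonal (α ∘ ⇑τ)) w)} : Set (archLocal L 3 (Matrix.diagonal (α ∘ ⇑τ)) w))))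
    (hνH : ∀ w τ, (νH w τ).IsHaarMeasure ∧ (νH w τ).IsInvInvariant)
    {κ : Type*} (z0 : κ → {w : InfinitePlace L // IsComplex w} → Fin 3 → Circle)
    (hwall : ∀ k w, z0 k w 0 = z0 k w 2 ∧ z0 k w 0 ≠ z0 k w 1) :
    ∃ ρZ : ∀ (k : κ) (w : {w : InfinitePlace L // IsComplex w}) (σ : Perm (Fin 3)), Measure (Subgroup.centralizer ({(⟨circleDiagonal 3 (z0 k w ∘ ⇑σ), circleDiagonal_mem_archLocal_diagonal L 3 α w (z0 k w ∘ ⇑σ)⟩ : archLocal L 3 (Matrix.diagonal α) w)} : Set (archLocal L 3 (Matrix.diagonal α) w))),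
      (∀ k w σ, (ρZ k w σ).IsHaarMeasure ∧ (ρZ k w σ).IsInvInvariant) ∧
      (∀ (k : κ) (w : {w : InfinitePlace L // IsComplex w}) (σ : Perm (Fin 3)), ¬ 0 < (w.1.embedding (α (σ⁻¹ 0))).re * (w.1.embedding (α (σ⁻¹ 2))).re →
        ρZ k w σ = (νH w σ⁻¹).map (subgroupCongrHomeomorph (ContinuousMulEquiv.restrictSubgroup (GLn.conjEquiv (Matrix.GeneralLinearGroup.mkOfDetNeZero _ (det_monomial_one_ne_zero 3 σ⁻¹))) (archLocal L 3 (Matrix.diagonal (α ∘ ⇑σ⁻¹)) w) (archLocal L 3 (Matrix.diagonal α) w) (mem_archLocal_comp_perm_iff_conj_mem L 3 α w σ⁻¹)).toMulEquiv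
        (Subgroup.centralizer ({(⟨circleDiagonal 3 (z₁ w), circleDiagonal_mem_archLocal_diagonal L 3 (α ∘ ⇑σ⁻¹) w (z₁ w)⟩ : archLocal L 3 (Matrix.diagonal (α ∘ ⇑σ⁻¹)) w)} : Set (archLocal L 3 (Matrix.diagonal (α ∘ ⇑σ⁻¹)) w)))
        (Subgroup.centralizer ({(⟨circleDiagonal 3 (z0 k w ∘ ⇑σ), circleDiagonal_mem_archLocal_diagonal L 3 α w (z0 k w ∘ ⇑σ)⟩ : archLocal L 3 (Matrix.diagonal α) w)} : Set (archLocal L 3 (Matrix.diagonal α) w)))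
        (relabel_inv_mem_centralizer_circleDiagonal_comp_iff L α w σ (h02 w) (h01 w) (hwall k w).1 (hwall k w).2)
        (ContinuousMulEquiv.restrictSubgroup (GLn.conjEquiv (Matrix.GeneralLinearGroup.mkOfDetNeZero _ (det_monomial_one_ne_zero 3 σ⁻¹))) (archLocal L 3 (Matrix.diagonal (α ∘ ⇑σ⁻¹)) w) (archLocal L 3 (Matrix.diagonal α) w) (mem_archLocal_comp_perm_iff_conj_mem L 3 α w σ⁻¹)).continuous
        (ContinuousMulEquiv.restrictSubgroup (GLn.conjEquiv (Matrix.GeneralLinearGroup.mkOfDetNeZero _ (det_monomial_one_ne_zero 3 σ⁻¹))) (archLocal L 3 (Matrix.diagonal (α ∘ ⇑σ⁻¹)) w) (archLocal L 3 (Matrix.diagonal α) w) (mem_archLocal_comp_perm_iff_conj_mem L 3 α w σ⁻¹)).symm.continuous)) ∧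
      (∀ (k : κ) (w : {w : InfinitePlace L // IsComplex w}) (σ : Perm (Fin 3)), 0 < (w.1.embedding (α (σ⁻¹ 0))).re * (w.1.embedding (α (σ⁻¹ 2))).re → ρZ k w σ Set.univ = 1) := by
  classical
  haveI iSC : ∀ w : {w : InfinitePlace L // IsComplex w}, SecondCountableTopology (archLocal L 3 (Matrix.diagonal α) w) := fun w => secondCountableTopology_archLocal L 3 (Matrix.diagonal α) w
  haveI iLC : ∀ w : {w : InfinitePlace L // IsComplex w}, LocallyCompactSpace (archLocal L 3 (Matrix.diagonal α) w) := fun w => locallyCompactSpace_archLocal L 3 (Matrix.diagonal α) w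
  -- compact walls: the probability Haar measure
  have hc : ∀ (k : κ) (w : {w : InfinitePlace L // IsComplex w}) (σ : Perm (Fin 3)), 0 < (w.1.embedding (α (σ⁻¹ 0))).re * (w.1.embedding (α (σ⁻¹ 2))).re →
      ∃ t : Measure (Subgroup.centralizer ({(⟨circleDiagonal 3 (z0 k w ∘ ⇑σ), circleDiagonal_mem_archLocal_diagonal L 3 α w (z0 k w ∘ ⇑σ)⟩ : archLocal L 3 (Matrix.diagonal α) w)} : Set (archLocal L 3 (Matrix.diagonal α) w))), t.IsHaarMeasure ∧ t.IsInvInvariant ∧ t Set.univ = 1 := fun k w σ h => by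
    haveI : CompactSpace (Subgroup.centralizer ({(⟨circleDiagonal 3 (z0 k w ∘ ⇑σ), circleDiagonal_mem_archLocal_diagonal L 3 α w (z0 k w ∘ ⇑σ)⟩ : archLocal L 3 (Matrix.diagonal α) w)} : Set (archLocal L 3 (Matrix.diagonal α) w))) :=
      isCompact_iff_compactSpace.mp (isCompact_centralizer_circleDiagonal_comp_of_pos L α w hα (hreal w) σ h (hwall k w).1 (hwall k w).2)
    exact exists_isHaarMeasure_isInvInvariant_univ_eq_one _
  refine ⟨fun k w σ => if h : 0 < (w.1.embedding (α (σ⁻¹ 0))).re * (w.1.embedding (α (σ⁻¹ 2))).re then (hc k w σ h).choose else (νH w σ⁻¹).map (subgroupCongrHomeomorph (ContinuousMulEquiv.restrictSubgroup (GLn.conjEquiv (Matrix.GeneralLinearGroup.mkOfDetNeZero _ (det_monomial_one_ne_zero 3 σ⁻¹))) (archLocal L 3 (Matrix.diagonal (α ∘ ⇑σ⁻¹)) w) (archLocal L 3 (Matrix.diagonal α) w) (mem_archLocal_comp_perm_iff_conj_mem L 3 α w σ⁻¹)).toMulEquiv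
        (Subgroup.centralizer ({(⟨circleDiagonal 3 (z₁ w), circleDiagonal_mem_archLocal_diagonal L 3 (α ∘ ⇑σ⁻¹) w (z₁ w)⟩ : archLocal L 3 (Matrix.diagonal (α ∘ ⇑σ⁻¹)) w)} : Set (archLocal L 3 (Matrix.diagonal (α ∘ ⇑σ⁻¹)) w)))
        (Subgroup.centralizer ({(⟨circleDiagonal 3 (z0 k w ∘ ⇑σ), circleDiagonal_mem_archLocal_diagonal L 3 α w (z0 k w ∘ ⇑σ)⟩ : archLocal L 3 (Matrix.diagonal α) w)} : Set (archLocal L 3 (Matrix.diagonal α) w)))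
        (relabel_inv_mem_centralizer_circleDiagonal_comp_iff L α w σ (h02 w) (h01 w) (hwall k w).1 (hwall k w).2)
        (ContinuousMulEquiv.restrictSubgroup (GLn.conjEquiv (Matrix.GeneralLinearGroup.mkOfDetNeZero _ (det_monomial_one_ne_zero 3 σ⁻¹))) (archLocal L 3 (Matrix.diagonal (α ∘ ⇑σ⁻¹)) w) (archLocal L 3 (Matrix.diagonal α) w) (mem_archLocal_comp_perm_iff_conj_mem L 3 α w σ⁻¹)).continuous
        (ContinuousMulEquiv.restrictSubgroup (GLn.conjEquiv (Matrix.GeneralLinearGroup.mkOfDetNeZero _ (det_monomial_one_ne_zero 3 σ⁻¹))) (archLocal L 3 (Matrix.diagonal (α ∘ ⇑σ⁻¹)) w) (archLocal L 3 (Matrix.diagonal α) w) (mem_archLocal_comp_perm_iff_conj_mem L 3 α w σ⁻¹)).symm.continuous), fun k w σ => ?_, fun k w σ h => ?_, fun k w σ h => ?_⟩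
  · by_cases h : 0 < (w.1.embedding (α (σ⁻¹ 0))).re * (w.1.embedding (α (σ⁻¹ 2))).re
    · simp only [dif_pos h]
      exact ⟨(hc k w σ h).choose_spec.1, (hc k w σ h).choose_spec.2.1⟩
    · simp only [dif_neg h]
      haveI := (hνH w σ⁻¹).1
      haveI := (hνH w σ⁻¹).2
      haveI : LocallyCompactSpace (archLocal L 3 (Matrix.diagonal (α ∘ ⇑σ⁻¹)) w) := locallyCompactSpace_archLocal L 3 (Matrix.diagonal (α ∘ ⇑σ⁻¹)) w
      haveI : LocallyCompactSpace (Subgroup.centralizer ({(⟨circleDiagonal 3 (z₁ w), circleDiagonal_mem_archLocal_diagonal L 3 (α ∘ ⇑σ⁻¹) w (z₁ w)⟩ : archLocal L 3 (Matrix.diagonal (α ∘ ⇑σ⁻¹)) w)} : Set (archLocal L 3 (Matrix.diagonal (α ∘ ⇑σ⁻¹)) w))) := (isClosed_coe_centralizer_singleton _).isClosedEmbedding_subtypeVal.locallyCompactSpace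
      exact ⟨isHaarMeasure_map_subgroupCongrHomeomorph _ _ _ _ _ _ (νH w σ⁻¹), isInvInvariant_map_subgroupCongrHomeomorph _ _ _ _ _ _ (νH w σ⁻¹)⟩
  · simp only [dif_neg h]
  · simp only [dif_pos h]
    exact (hc k w σ h).choose_spec.2.2

/-- **ONE-STOP (ST-∞) SINGULAR-PIN FEED.**  Reference wall measures `νH w τ` (Haar, inversion invariant) with their within-place links (T02)∕(T01) (★ `centralizer_measure_links_of_clause_neg_one`
from the self-normalising pin) and an injective family of wall data in normal form ⟹ pinned families `ρZ` (★ (D5)'s `hρZi hρZ` + probability at compact walls), telescopes `ρP ρ′`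
(`hρPi hρP hρ′i hρ′`) and ONE torus datum `T` with `T (t(z0 k∘ρ)) = ρ′ k ρ`, Haar inversion-invariant and conjugation-coherent on the union of the wall classes (★ (W3-all)).
[cite: Rogawski1990, §1.7 p. 6; §4.3 (4.3.1) p. 43; §8.2 pp. 122–124] [cite: DeitmarEchterhoff2014, Thm. 1.5.3] -/
theorem exists_pins_conj_coherent_telescope_all
    [MeasurableSpace (arch (↥(maximalRealSubfield L)) L (IsCMField.complexConj L) 3 (Matrix.diagonal α))] [BorelSpace (arch (↥(maximalRealSubfield L)) L (IsCMField.complexConj L) 3 (Matrix.diagonal α))]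
    (hα : ∀ i, α i ≠ 0) (hreal : ∀ (w : {w : InfinitePlace L // IsComplex w}) (i : Fin 3), (w.1.embedding (α i)).im = 0)
    (z₁ : {w : InfinitePlace L // IsComplex w} → Fin 3 → Circle) (h02 : ∀ w, z₁ w 0 = z₁ w 2) (h01 : ∀ w, z₁ w 0 ≠ z₁ w 1)
    (νH : ∀ (w : {w : InfinitePlace L // IsComplex w}) (τ : Perm (Fin 3)), Measure (Subgroup.centralizer ({(⟨circleDiagonal 3 (z₁ w), circleDiagonal_mem_archLocal_diagonal L 3 (α ∘ ⇑τ) w (z₁ w)⟩ : archLocal L 3 (Matrix.diagonal (α ∘ ⇑τ)) w)} : Set (archLocal L 3 (Matrix.diagonal (α ∘ ⇑τ)) w))))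
    (hνH : ∀ w τ, (νH w τ).IsHaarMeasure ∧ (νH w τ).IsInvInvariant)
    (hT02 : ∀ (w : {w : InfinitePlace L // IsComplex w}) (τ : Perm (Fin 3)), (w.1.embedding (α (τ 0))).re * (w.1.embedding (α (τ 2))).re < 0 →
      νH w τ = (νH w (τ * Equiv.swap (0 : Fin 3) 2)).map (subgroupCongrHomeomorph (ContinuousMulEquiv.restrictSubgroup (GLn.conjEquiv (Matrix.GeneralLinearGroup.mkOfDetNeZero _ (det_monomial_one_ne_zero 3 (Equiv.swap (0 : Fin 3) 2)))) (archLocal L 3 (Matrix.diagonal ((α ∘ ⇑τ) ∘ ⇑(Equiv.swap (0 : Fin 3) 2))) w) (archLocal L 3 (Matrix.diagonal (α ∘ ⇑τ)) w) (mem_archLocal_comp_perm_iff_conj_mem L 3 (α ∘ ⇑τ) w (Equiv.swap (0 : Fin 3) 2))).toMulEquiv (Subgroup.centralizer ({(⟨circleDiagonal 3 (z₁ w), circleDiagonal_mem_archLocal_diagonal L 3 ((α ∘ ⇑τ) ∘ ⇑(Equiv.swap (0 : Fin 3) 2)) w (z₁ w)⟩ : archLocal L 3 (Matrix.diagonal ((α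 ∘ ⇑τ) ∘ ⇑(Equiv.swap (0 : Fin 3) 2))) w)} : Set (archLocal L 3 (Matrix.diagonal ((α ∘ ⇑τ) ∘ ⇑(Equiv.swap (0 : Fin 3) 2))) w))) (Subgroup.centralizer ({(⟨circleDiagonal 3 (z₁ w), circleDiagonal_mem_archLocal_diagonal L 3 (α ∘ ⇑τ) w (z₁ w)⟩ : archLocal L 3 (Matrix.diagonal (α ∘ ⇑τ)) w)} : Set (archLocal L 3 (Matrix.diagonal (α ∘ ⇑τ)) w))) (forall_apply_mem_centralizer_singleton_iff_of_eq (ContinuousMulEquiv.restrictSubgroup (GLn.conjEquiv (Matrix.GeneralLinearGroup.mkOfDetNeZero _ (det_monomial_one_ne_zero 3 (Equiv.swap (0 : Fin 3) 2)))) (archLocal L 3 (Matrix.diagonal ((α ∘ ⇑τ) ∘ ⇑(Equiv.swap (0 : Fin 3) 2))) w) (archLocal L 3 (Matrix.diagonal (α ∘ ⇑τ)) w) (mem_archLocal_comp_perm_iff_conj_mem L 3 (α ∘ ⇑τ) w (Equiv.swap (0 : Fin 3) 2))).toMulEquiv ((relabel_circleDiagonal L 3 (α ∘ ⇑τ) w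 (Equiv.swap (0 : Fin 3) 2) (z₁ w)).trans (Subtype.ext (congrArg (circleDiagonal 3) (comp_swap02_symm_eq_self_of_wall (z₁ w) (h02 w)))))) (ContinuousMulEquiv.restrictSubgroup (GLn.conjEquiv (Matrix.GeneralLinearGroup.mkOfDetNeZero _ (det_monomial_one_ne_zero 3 (Equiv.swap (0 : Fin 3) 2)))) (archLocal L 3 (Matrix.diagonal ((α ∘ ⇑τ) ∘ ⇑(Equiv.swap (0 : Fin 3) 2))) w) (archLocal L 3 (Matrix.diagonal (α ∘ ⇑τ)) w) (mem_archLocal_comp_perm_iff_conj_mem L 3 (α ∘ ⇑τ) w (Equiv.swap (0 : Fin 3) 2))).continuous (ContinuousMulEquiv.restrictSubgroup (GLn.conjEquiv (Matrix.GeneralLinearGroup.mkOfDetNeZero _ (det_monomial_one_ne_zero 3 (Equiv.swap (0 : Fin 3) 2)))) (archLocal L 3 (Matrix.diagonal ((α ∘ ⇑τ) ∘ ⇑(Equiv.swap (0 : Fin 3) 2))) w) (archLocal L 3 (Matrix.diagonal (α ∘ ⇑τ)) w) (mem_archLocal_comp_perm_iff_conj_mem L 3 (α ∘ ⇑τ)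 w (Equiv.swap (0 : Fin 3) 2))).symm.continuous))
    (hT01 : ∀ (w : {w : InfinitePlace L // IsComplex w}) (τ : Perm (Fin 3)), (w.1.embedding (α (τ 0))).re * (w.1.embedding (α (τ 2))).re < 0 →
      ∀ (h01s : 0 < (w.1.embedding ((α ∘ ⇑τ) 0)).re * (w.1.embedding ((α ∘ ⇑τ) 1)).re),
      νH w (τ * Equiv.swap (0 : Fin 3) 1) = (νH w τ).map (subgroupCongrHomeomorph (ContinuousMulEquiv.restrictSubgroup (GLn.conjEquiv (Matrix.GeneralLinearGroup.mkOfDetNeZero (Matrix.diagonal ![((Real.sqrt ((w.1.embedding ((α ∘ ⇑τ) 0)).re / (w.1.embedding ((α ∘ ⇑τ) 1)).re) : ℝ) : ℂ), ((Real.sqrt ((w.1.embedding ((α ∘ ⇑τ) 1)).re / (w.1.embedding ((α ∘ ⇑τ) 0)).re) : ℝ) : ℂ), 1]) (det_rescale01_ne_zero h01s))) (archLocal L 3 (Matrix.diagonal (α ∘ ⇑τ)) w) (archLocal L 3 (Matrix.diagonal ((α ∘ ⇑τ) ∘ ⇑(Equiv.swap (0 : Fin 3) 1))) w) (mem_archLocal_diagonal_iff_conjEquiv_mem_of_formCongr_eq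 L 3 (α ∘ ⇑τ) ((α ∘ ⇑τ) ∘ ⇑(Equiv.swap (0 : Fin 3) 1)) w (Matrix.GeneralLinearGroup.mkOfDetNeZero (Matrix.diagonal ![((Real.sqrt ((w.1.embedding ((α ∘ ⇑τ) 0)).re / (w.1.embedding ((α ∘ ⇑τ) 1)).re) : ℝ) : ℂ), ((Real.sqrt ((w.1.embedding ((α ∘ ⇑τ) 1)).re / (w.1.embedding ((α ∘ ⇑τ) 0)).re) : ℝ) : ℂ), 1]) (det_rescale01_ne_zero h01s)) (formCongr_rescale01_map_diagonal L (α ∘ ⇑τ) w (fun i => hreal w (τ i)) h01s))).toMulEquiv (Subgroup.centralizer ({(⟨circleDiagonal 3 (z₁ w), circleDiagonal_mem_archLocal_diagonal L 3 (α ∘ ⇑τ) w (z₁ w)⟩ : archLocal L 3 (Matrix.diagonal (α ∘ ⇑τ)) w)} : Set (archLocal L 3 (Matrix.diagonal (α ∘ ⇑τ)) w))) (Subgroup.centralizer ({(⟨circleDiagonal 3 (z₁ w), circleDiagonal_mem_archLocal_diagonal L 3 ((α ∘ ⇑τ) ∘ ⇑(Equiv.swap (0 : Fin 3) 1)) w (z₁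 w)⟩ : archLocal L 3 (Matrix.diagonal ((α ∘ ⇑τ) ∘ ⇑(Equiv.swap (0 : Fin 3) 1))) w)} : Set (archLocal L 3 (Matrix.diagonal ((α ∘ ⇑τ) ∘ ⇑(Equiv.swap (0 : Fin 3) 1))) w))) (forall_apply_mem_centralizer_singleton_iff_of_eq (ContinuousMulEquiv.restrictSubgroup (GLn.conjEquiv (Matrix.GeneralLinearGroup.mkOfDetNeZero (Matrix.diagonal ![((Real.sqrt ((w.1.embedding ((α ∘ ⇑τ) 0)).re / (w.1.embedding ((α ∘ ⇑τ) 1)).re) : ℝ) : ℂ), ((Real.sqrt ((w.1.embedding ((α ∘ ⇑τ) 1)).re / (w.1.embedding ((α ∘ ⇑τ) 0)).re) : ℝ) : ℂ), 1]) (det_rescale01_ne_zero h01s))) (archLocal L 3 (Matrix.diagonal (α ∘ ⇑τ)) w) (archLocal L 3 (Matrix.diagonal ((α ∘ ⇑τ) ∘ ⇑(Equiv.swap (0 : Fin 3) 1))) w) (mem_archLocal_diagonal_iff_conjEquiv_mem_of_formCongr_eq L 3 (α ∘ ⇑τ) ((α ∘ ⇑τ) ∘ ⇑(Equiv.swap (0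 : Fin 3) 1)) w (Matrix.GeneralLinearGroup.mkOfDetNeZero (Matrix.diagonal ![((Real.sqrt ((w.1.embedding ((α ∘ ⇑τ) 0)).re / (w.1.embedding ((α ∘ ⇑τ) 1)).re) : ℝ) : ℂ), ((Real.sqrt ((w.1.embedding ((α ∘ ⇑τ) 1)).re / (w.1.embedding ((α ∘ ⇑τ) 0)).re) : ℝ) : ℂ), 1]) (det_rescale01_ne_zero h01s)) (formCongr_rescale01_map_diagonal L (α ∘ ⇑τ) w (fun i => hreal w (τ i)) h01s))).toMulEquiv (congrT_circleDiagonal L 3 (α ∘ ⇑τ) ((α ∘ ⇑τ) ∘ ⇑(Equiv.swap (0 : Fin 3) 1)) w (Matrix.GeneralLinearGroup.mkOfDetNeZero (Matrix.diagonal ![((Real.sqrt ((w.1.embedding ((α ∘ ⇑τ) 0)).re / (w.1.embedding ((α ∘ ⇑τ) 1)).re) : ℝ) : ℂ), ((Real.sqrt ((w.1.embedding ((α ∘ ⇑τ) 1)).re / (w.1.embedding ((α ∘ ⇑τ) 0)).re) : ℝ) : ℂ), 1]) (det_rescale01_ne_zero h01s)) (formCongr_rescale01_map_diagonal L (α ∘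 ⇑τ) w (fun i => hreal w (τ i)) h01s) (rescale01_conj_circleDiagonal L (α ∘ ⇑τ) w h01s) (z₁ w))) (ContinuousMulEquiv.restrictSubgroup (GLn.conjEquiv (Matrix.GeneralLinearGroup.mkOfDetNeZero (Matrix.diagonal ![((Real.sqrt ((w.1.embedding ((α ∘ ⇑τ) 0)).re / (w.1.embedding ((α ∘ ⇑τ) 1)).re) : ℝ) : ℂ), ((Real.sqrt ((w.1.embedding ((α ∘ ⇑τ) 1)).re / (w.1.embedding ((α ∘ ⇑τ) 0)).re) : ℝ) : ℂ), 1]) (det_rescale01_ne_zero h01s))) (archLocal L 3 (Matrix.diagonal (α ∘ ⇑τ)) w) (archLocal L 3 (Matrix.diagonal ((α ∘ ⇑τ) ∘ ⇑(Equiv.swap (0 : Fin 3) 1))) w) (mem_archLocal_diagonal_iff_conjEquiv_mem_of_formCongr_eq L 3 (α ∘ ⇑τ) ((α ∘ ⇑τ) ∘ ⇑(Equiv.swap (0 : Fin 3) 1)) w (Matrix.GeneralLinearGroup.mkOfDetNeZero (Matrix.diagonal ![((Real.sqrt ((w.1.embedding ((α ∘ ⇑τ) 0)).re / (w.1.embedding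 ((α ∘ ⇑τ) 1)).re) : ℝ) : ℂ), ((Real.sqrt ((w.1.embedding ((α ∘ ⇑τ) 1)).re / (w.1.embedding ((α ∘ ⇑τ) 0)).re) : ℝ) : ℂ), 1]) (det_rescale01_ne_zero h01s)) (formCongr_rescale01_map_diagonal L (α ∘ ⇑τ) w (fun i => hreal w (τ i)) h01s))).continuous (ContinuousMulEquiv.restrictSubgroup (GLn.conjEquiv (Matrix.GeneralLinearGroup.mkOfDetNeZero (Matrix.diagonal ![((Real.sqrt ((w.1.embedding ((α ∘ ⇑τ) 0)).re / (w.1.embedding ((α ∘ ⇑τ) 1)).re) : ℝ) : ℂ), ((Real.sqrt ((w.1.embedding ((α ∘ ⇑τ) 1)).re / (w.1.embedding ((α ∘ ⇑τ) 0)).re) : ℝ) : ℂ), 1]) (det_rescale01_ne_zero h01s))) (archLocal L 3 (Matrix.diagonal (α ∘ ⇑τ)) w) (archLocal L 3 (Matrix.diagonal ((α ∘ ⇑τ) ∘ ⇑(Equiv.swap (0 : Fin 3) 1))) w) (mem_archLocal_diagonal_iff_conjEquiv_mem_of_formCongr_eq L 3 (α ∘ ⇑τ) ((α ∘ ⇑τ)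 ∘ ⇑(Equiv.swap (0 : Fin 3) 1)) w (Matrix.GeneralLinearGroup.mkOfDetNeZero (Matrix.diagonal ![((Real.sqrt ((w.1.embedding ((α ∘ ⇑τ) 0)).re / (w.1.embedding ((α ∘ ⇑τ) 1)).re) : ℝ) : ℂ), ((Real.sqrt ((w.1.embedding ((α ∘ ⇑τ) 1)).re / (w.1.embedding ((α ∘ ⇑τ) 0)).re) : ℝ) : ℂ), 1]) (det_rescale01_ne_zero h01s)) (formCongr_rescale01_map_diagonal L (α ∘ ⇑τ) w (fun i => hreal w (τ i)) h01s))).symm.continuous))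
    {κ : Type*} (z0 : κ → {w : InfinitePlace L // IsComplex w} → Fin 3 → Circle)
    (hwall : ∀ k w, z0 k w 0 = z0 k w 2 ∧ z0 k w 0 ≠ z0 k w 1) (hinj : Function.Injective z0) :
    ∃ (ρZ : ∀ (k : κ) (w : {w : InfinitePlace L // IsComplex w}) (σ : Perm (Fin 3)), Measure (Subgroup.centralizer ({(⟨circleDiagonal 3 (z0 k w ∘ ⇑σ), circleDiagonal_mem_archLocal_diagonal L 3 α w (z0 k w ∘ ⇑σ)⟩ : archLocal L 3 (Matrix.diagonal α) w)} : Set (archLocal L 3 (Matrix.diagonal α) w))))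
      (ρP : ∀ (k : κ) (ρ : {w : InfinitePlace L // IsComplex w} → Perm (Fin 3)), Measure (Subgroup.pi Set.univ (fun w : {w : InfinitePlace L // IsComplex w} => Subgroup.centralizer ({(⟨circleDiagonal 3 (z0 k w ∘ ⇑(ρ w)), circleDiagonal_mem_archLocal_diagonal L 3 α w (z0 k w ∘ ⇑(ρ w))⟩ : archLocal L 3 (Matrix.diagonal α) w)} : Set (archLocal L 3 (Matrix.diagonal α) w)))))
      (ρ' : ∀ (k : κ) (ρ : {w : InfinitePlace L // IsComplex w} → Perm (Fin 3)), Measure (Subgroup.centralizer ({archDiagTorus L 3 α (fun w => z0 k w ∘ ⇑(ρ w))} : Set (arch (↥(maximalRealSubfield L)) L (IsCMField.complexConj L) 3 (Matrix.diagonal α)))))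
      (T : ∀ γ : arch (↥(maximalRealSubfield L)) L (IsCMField.complexConj L) 3 (Matrix.diagonal α), Measure (Subgroup.centralizer ({γ} : Set (arch (↥(maximalRealSubfield L)) L (IsCMField.complexConj L) 3 (Matrix.diagonal α))))),
      (∀ k w σ, (ρZ k w σ).IsHaarMeasure ∧ (ρZ k w σ).IsInvInvariant) ∧
      (∀ (k : κ) (w : {w : InfinitePlace L // IsComplex w}) (σ : Perm (Fin 3)), ¬ 0 < (w.1.embedding (α (σ⁻¹ 0))).re * (w.1.embedding (α (σ⁻¹ 2))).re →
        ρZ k w σ = (νH w σ⁻¹).map (subgroupCongrHomeomorph (ContinuousMulEquiv.restrictSubgroup (GLn.conjEquiv (Matrix.GeneralLinearGroup.mkOfDetNeZero _ (det_monomial_one_ne_zero 3 σ⁻¹))) (archLocal L 3 (Matrix.diagonal (α ∘ ⇑σ⁻¹)) w) (archLocal L 3 (Matrix.diagonal α) w) (mem_archLocal_comp_perm_iff_conj_mem L 3 α w σ⁻¹)).toMulEquiv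
        (Subgroup.centralizer ({(⟨circleDiagonal 3 (z₁ w), circleDiagonal_mem_archLocal_diagonal L 3 (α ∘ ⇑σ⁻¹) w (z₁ w)⟩ : archLocal L 3 (Matrix.diagonal (α ∘ ⇑σ⁻¹)) w)} : Set (archLocal L 3 (Matrix.diagonal (α ∘ ⇑σ⁻¹)) w)))
        (Subgroup.centralizer ({(⟨circleDiagonal 3 (z0 k w ∘ ⇑σ), circleDiagonal_mem_archLocal_diagonal L 3 α w (z0 k w ∘ ⇑σ)⟩ : archLocal L 3 (Matrix.diagonal α) w)} : Set (archLocal L 3 (Matrix.diagonal α) w)))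
        (relabel_inv_mem_centralizer_circleDiagonal_comp_iff L α w σ (h02 w) (h01 w) (hwall k w).1 (hwall k w).2)
        (ContinuousMulEquiv.restrictSubgroup (GLn.conjEquiv (Matrix.GeneralLinearGroup.mkOfDetNeZero _ (det_monomial_one_ne_zero 3 σ⁻¹))) (archLocal L 3 (Matrix.diagonal (α ∘ ⇑σ⁻¹)) w) (archLocal L 3 (Matrix.diagonal α) w) (mem_archLocal_comp_perm_iff_conj_mem L 3 α w σ⁻¹)).continuous
        (ContinuousMulEquiv.restrictSubgroup (GLn.conjEquiv (Matrix.GeneralLinearGroup.mkOfDetNeZero _ (det_monomial_one_ne_zero 3 σ⁻¹))) (archLocal L 3 (Matrix.diagonal (α ∘ ⇑σ⁻¹)) w) (archLocal L 3 (Matrix.diagonal α) w) (mem_archLocal_comp_perm_iff_conj_mem L 3 α w σ⁻¹)).symm.continuous)) ∧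
      (∀ (k : κ) (w : {w : InfinitePlace L // IsComplex w}) (σ : Perm (Fin 3)), 0 < (w.1.embedding (α (σ⁻¹ 0))).re * (w.1.embedding (α (σ⁻¹ 2))).re → ρZ k w σ Set.univ = 1) ∧
      (∀ k ρ, (ρP k ρ).IsHaarMeasure ∧ (ρP k ρ).IsInvInvariant) ∧
      (∀ (k : κ) (ρ : {w : InfinitePlace L // IsComplex w} → Perm (Fin 3)), Measure.map (subgroupPiCoords fun w : {w : InfinitePlace L // IsComplex w} => Subgroup.centralizer ({(⟨circleDiagonal 3 (z0 k w ∘ ⇑(ρ w)), circleDiagonal_mem_archLocal_diagonal L 3 α w (z0 k w ∘ ⇑(ρ w))⟩ : archLocal L 3 (Matrix.diagonal α) w)} : Set (archLocal L 3 (Matrix.diagonal α) w))) (ρP k ρ) = Measure.pi fun w => ρZ k w (ρ w)) ∧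
      (∀ k ρ, (ρ' k ρ).IsHaarMeasure ∧ (ρ' k ρ).IsInvInvariant) ∧
      (∀ (k : κ) (ρ : {w : InfinitePlace L // IsComplex w} → Perm (Fin 3)), ρ' k ρ = (ρP k ρ).map (subgroupCongrHomeomorph (archPiEquivCM 3 L (Matrix.diagonal α)).symm.toMulEquiv (Subgroup.pi Set.univ (fun w : {w : InfinitePlace L // IsComplex w} => Subgroup.centralizer ({(⟨circleDiagonal 3 (z0 k w ∘ ⇑(ρ w)), circleDiagonal_mem_archLocal_diagonal L 3 α w (z0 k w ∘ ⇑(ρ w))⟩ : archLocal L 3 (Matrix.diagonal α) w)} : Set (archLocal L 3 (Matrix.diagonal α) w)))) (Subgroup.centralizer ({archDiagTorus L 3 α (fun w => z0 k w ∘ ⇑(ρ w))} : Set (arch (↥(maximalRealSubfield L)) L (IsCMField.complexConj L) 3 (Matrix.diagonal α)))) (apply_mem_centralizer_iff_mem_pi_centralizer _ (archPiEquivCM 3 L (Matrix.diagonal α)).symm.toMulEquiv (archPiEquivCM_symm_circleDiagonal_eq_archDiagTorus L 3 α (fun w => z0 k w ∘ ⇑(ρ w)))) (archPiEquivCM 3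 L (Matrix.diagonal α)).symm.continuous (archPiEquivCM 3 L (Matrix.diagonal α)).continuous)) ∧
      (∀ (k : κ) (ρ : {w : InfinitePlace L // IsComplex w} → Perm (Fin 3)), T (archDiagTorus L 3 α (fun w => z0 k w ∘ ⇑(ρ w))) = ρ' k ρ) ∧
      (∀ γ : arch (↥(maximalRealSubfield L)) L (IsCMField.complexConj L) 3 (Matrix.diagonal α), (∃ (k : κ) (ρ : {w : InfinitePlace L // IsComplex w} → Perm (Fin 3)) (q : arch (↥(maximalRealSubfield L)) L (IsCMField.complexConj L) 3 (Matrix.diagonal α)), (MulAut.conj q : arch (↥(maximalRealSubfield L)) L (IsCMField.complexConj L) 3 (Matrix.diagonal α) ≃* arch (↥(maximalRealSubfield L)) L (IsCMField.complexConj L) 3 (Matrix.diagonal α)) (archDiagTorus L 3 α (fun w => z0 k w ∘ ⇑(ρ w))) = γ) →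
        ∃ (k : κ) (ρ : {w : InfinitePlace L // IsComplex w} → Perm (Fin 3)) (q : arch (↥(maximalRealSubfield L)) L (IsCMField.complexConj L) 3 (Matrix.diagonal α)) (h : (MulAut.conj q : arch (↥(maximalRealSubfield L)) L (IsCMField.complexConj L) 3 (Matrix.diagonal α) ≃* arch (↥(maximalRealSubfield L)) L (IsCMField.complexConj L) 3 (Matrix.diagonal α)) (archDiagTorus L 3 α (fun w => z0 k w ∘ ⇑(ρ w))) = γ), T γ = (ρ' k ρ).map (subgroupCongrHomeomorph (MulAut.conj q : arch (↥(maximalRealSubfield L)) L (IsCMField.complexConj L) 3 (Matrix.diagonal α) ≃* arch (↥(maximalRealSubfield L)) L (IsCMField.complexConj L) 3 (Matrix.diagonal α)) (Subgroup.centralizer ({archDiagTorus L 3 α (fun w => z0 k w ∘ ⇑(ρ w))} : Set (arch (↥(maximalRealSubfield L)) L (IsCMField.complexConj L) 3 (Matrix.diagonal α)))) (Subgroup.centralizer ({γ} : Set (arch (↥(maximalRealSubfield L)) L (IsCMField.complexConj L) 3 (Matrix.diagonal α)))) (forall_apply_mem_centralizer_singleton_iff_of_eq (MulAut.conj q : arch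 (↥(maximalRealSubfield L)) L (IsCMField.complexConj L) 3 (Matrix.diagonal α) ≃* arch (↥(maximalRealSubfield L)) L (IsCMField.complexConj L) 3 (Matrix.diagonal α)) h) (continuous_mulAutConj q) (continuous_mulAutConj_symm q))) ∧
      (∀ γ : arch (↥(maximalRealSubfield L)) L (IsCMField.complexConj L) 3 (Matrix.diagonal α), (∃ (k : κ) (ρ : {w : InfinitePlace L // IsComplex w} → Perm (Fin 3)) (q : arch (↥(maximalRealSubfield L)) L (IsCMField.complexConj L) 3 (Matrix.diagonal α)), (MulAut.conj q : arch (↥(maximalRealSubfield L)) L (IsCMField.complexConj L) 3 (Matrix.diagonal α) ≃* arch (↥(maximalRealSubfield L)) L (IsCMField.complexConj L) 3 (Matrix.diagonal α)) (archDiagTorus L 3 α (fun w => z0 k w ∘ ⇑(ρ w))) = γ) → (T γ).IsHaarMeasure ∧ (T γ).IsInvInvariant) ∧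
      ∀ (γ₁ γ₂ Q : arch (↥(maximalRealSubfield L)) L (IsCMField.complexConj L) 3 (Matrix.diagonal α)) (hQ : (MulAut.conj Q : arch (↥(maximalRealSubfield L)) L (IsCMField.complexConj L) 3 (Matrix.diagonal α) ≃* arch (↥(maximalRealSubfield L)) L (IsCMField.complexConj L) 3 (Matrix.diagonal α)) γ₁ = γ₂), (∃ (k : κ) (ρ : {w : InfinitePlace L // IsComplex w} → Perm (Fin 3)) (q : arch (↥(maximalRealSubfield L)) L (IsCMField.complexConj L) 3 (Matrix.diagonal α)), (MulAut.conj q : arch (↥(maximalRealSubfield L)) L (IsCMField.complexConj L) 3 (Matrix.diagonal α) ≃* arch (↥(maximalRealSubfield L)) L (IsCMField.complexConj L) 3 (Matrix.diagonal α)) (archDiagTorus L 3 α (fun w => z0 k w ∘ ⇑(ρ w))) = γ₁) →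
        (T γ₁).map (subgroupCongrHomeomorph (MulAut.conj Q : arch (↥(maximalRealSubfield L)) L (IsCMField.complexConj L) 3 (Matrix.diagonal α) ≃* arch (↥(maximalRealSubfield L)) L (IsCMField.complexConj L) 3 (Matrix.diagonal α)) (Subgroup.centralizer ({γ₁} : Set (arch (↥(maximalRealSubfield L)) L (IsCMField.complexConj L) 3 (Matrix.diagonal α)))) (Subgroup.centralizer ({γ₂} : Set (arch (↥(maximalRealSubfield L)) L (IsCMField.complexConj L) 3 (Matrix.diagonal α)))) (forall_apply_mem_centralizer_singleton_iff_of_eq (MulAut.conj Q : arch (↥(maximalRealSubfield L)) L (IsCMField.complexConj L) 3 (Matrix.diagonal α) ≃* arch (↥(maximalRealSubfield L)) L (IsCMField.complexConj L) 3 (Matrix.diagonal α)) hQ) (continuous_mulAutConj Q) (continuous_mulAutConj_symm Q)) = T γ₂ := by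
  obtain ⟨ρZ, hρZi, hρZ, hρZ1⟩ := exists_pinned_centralizer_families L α hα hreal z₁ h02 h01 νH hνH z0 hwall
  obtain ⟨ρP, ρ', T, h⟩ := exists_conj_coherent_pinned_telescope_all_of_links L α hα hreal z₁ h02 h01 νH hT02 hT01 z0 hinj hwall ρZ hρZi hρZ hρZ1
  exact ⟨ρZ, ρP, ρ', T, hρZi, hρZ, hρZ1, h⟩

end Literature.NumberTheory.Rogawski1990

end
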